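import Summits.Ventures.PercRepro.RankLevelSetRuleQSliceMapsModel
import Summits.Ventures.PercRepro.RankLevelSetRuleQStaircaseMapsB
import Summits.Ventures.PercRepro.RankLevelSetRuleQEightWhole

/-!
# PercRepro — THE COMPLETE SLICE MAP OF RULE Q EXTENDED TO THE FAMILY `k = 8` (night-1, gen 19; dossier §30)

With p4 g24's whole-regime theorem `rhat_eight_whole` (`m + 7 ≤ q`) and the thin-slice map `rhat_eight_slice_iff` (`u ≤ 10`,
RankLevelSetRuleQStaircaseMapsB) the slice map of the family `k = 8` loses its bound on the slice:
* **`rhat_eight_slice_iff_all`** — a slice `u` of the family `k = 8` is paid on EVERY cell `(q+8, q)` iff `u ∉ {2, 3, 4, 5}`;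
* **`rhat_slice_iff_all_eight`** — uniformly for `5 ≤ k ≤ 8`: iff `u ∉ [2, k − 3]`; **`rhat_slice_iff_le_eight`** — for
  `2 ≤ k ≤ 8`: iff `k ≤ 4 ∨ u < 2 ∨ k − 2 ≤ u`;
* **`ruleQ_slice_iff_le_eight`** — the matroid level (the model matroid for the negative half, `rhat_le_ruleQRecv` for the
  positive half): at the tight layer of every finite matroid of every cell `(q+k, q)`, `2 ≤ k ≤ 8`, the members at distance
  `u = q − #P` from the top are paid by Rule Q's equal split for every `q` iff `k ≤ 4 ∨ u ≤ 1 ∨ u ≥ k − 2`.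
Axioms: standard.
-/

namespace PercRepro

open Set Matroid

/-- **The family `k = 8`, every slice**: paid on EVERY cell `(q+8, q)` iff `u ∉ {2, 3, 4, 5}`. -/
theorem rhat_eight_slice_iff_all (u : ℕ) :
    (∀ q, u ≤ q → phiK (q + 8) q ≤ rhat q 8 (q - u)) ↔ (u ≠ 2 ∧ u ≠ 3 ∧ u ≠ 4 ∧ u ≠ 5) := by
  constructor
  · intro h
    refine ⟨fun hu2 => ?_, fun hu3 => ?_, fun hu4 => ?_, fun hu5 => ?_⟩
    · subst hu2; exact ((rhat_eight_slice_iff 2 (by norm_num)).1 h).1 rfl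
    · subst hu3; exact ((rhat_eight_slice_iff 3 (by norm_num)).1 h).2.1 rfl
    · subst hu4; exact ((rhat_eight_slice_iff 4 (by norm_num)).1 h).2.2.1 rfl
    · subst hu5; exact ((rhat_eight_slice_iff 5 (by norm_num)).1 h).2.2.2 rfl
  · rintro ⟨hu2, hu3, hu4, hu5⟩ q hq
    rcases Nat.lt_or_ge u 7 with hlt | hge
    · exact (rhat_eight_slice_iff u (by omega)).2 ⟨hu2, hu3, hu4, hu5⟩ q hq
    · exact rhat_eight_whole q (q - u) (by omega)

/-- **THE SLICE MAP OF THE FAMILIES `5 ≤ k ≤ 8`, COMPLETE AND EXACT**: the slice `u = q − #P` is paid on EVERY cell `(q+k, q)`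
iff `u ∉ [2, k − 3]`. -/
theorem rhat_slice_iff_all_eight (k u : ℕ) (hk5 : 5 ≤ k) (hk8 : k ≤ 8) :
    (∀ q, u ≤ q → phiK (q + k) q ≤ rhat q k (q - u)) ↔ (u < 2 ∨ k - 2 ≤ u) := by
  rcases Nat.lt_or_ge k 8 with hlt | hge
  · exact rhat_slice_iff_all k u hk5 (by omega)
  · have hk : k = 8 := by omega
    subst hk
    rw [rhat_eight_slice_iff_all u]; omega

/-- **THE SLICE MAP OF RULE Q ON EVERY FAMILY `2 ≤ k ≤ 8`**: paid on every cell iff `k ≤ 4`, or `u ≤ 1`, or `u ≥ k − 2`. -/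
theorem rhat_slice_iff_le_eight (k u : ℕ) (hk2 : 2 ≤ k) (hk8 : k ≤ 8) :
    (∀ q, u ≤ q → phiK (q + k) q ≤ rhat q k (q - u)) ↔ (k ≤ 4 ∨ u < 2 ∨ k - 2 ≤ u) := by
  rcases Nat.lt_or_ge k 5 with hlt | hge
  · exact ⟨fun _ => Or.inl (by omega), fun _ q hq => rhat_slice_of_le_four k u hk2 (by omega) q hq⟩
  · rw [rhat_slice_iff_all_eight k u hge hk8]
    omega

/-- **THE SLICE MAP AT THE MATROID LEVEL FOR EVERY FAMILY `2 ≤ k ≤ 8`**: the members at distance `u = q − #(flatPart Z)` from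
the top are paid by Rule Q's equal split at the tight layer of every finite matroid of every cell `(q+k, q)`, `q ≥ u`, if and
only if `k ≤ 4 ∨ u ≤ 1 ∨ u ≥ k − 2`. -/
theorem ruleQ_slice_iff_le_eight (k u : ℕ) (hk2 : 2 ≤ k) (hk8 : k ≤ 8) :
    (∀ (β : Type) (M : Matroid β) (hf : M.Finite) (q : ℕ), u ≤ q → M.E.ncard = (q + k) + q →
        ∀ Z ∈ cellMembers M (q + k) q, (flatPart M Z).ncard = q - u →
          phiK (q + k) q ≤ @ruleQRecv β M hf (q + k) q Z)
      ↔ (k ≤ 4 ∨ u < 2 ∨ k - 2 ≤ u) := by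
  constructor
  · intro h
    by_contra hu
    have h' := (rhat_slice_iff_le_eight k u hk2 hk8).not.2 hu
    push Not at h'
    obtain ⟨q, hq, hlt⟩ := h'
    obtain ⟨β, M, hf, Z, hE, hZ, hP, hrecv⟩ := modelRecvEq_flatPart q k (q - u) hk2 (Nat.sub_le q u)
    have h1 := h β M hf q hq hE Z hZ hP
    rw [hrecv] at h1
    exact absurd h1 (not_le.mpr hlt)
  · intro hu β M hf q hq hE Z hZ hP
    have h1 := (rhat_slice_iff_le_eight k u hk2 hk8).2 hu q hq
    have h2 := @rhat_le_ruleQRecv β M hf q k hE Z hZ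
    rw [hP] at h2
    exact h1.trans h2

end PercRepro
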